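import Literature.AlgebraicGeometry.Frobenioids.ArchimedeanIndissectible
import Literature.AlgebraicGeometry.Frobenioids.ArchimedeanIsotropy
import HarnessLib

/-!
# Frobenioids II, Theorem 3.6 (ix) — PROVED for the angular Frobenioid `A`: `A^istr` is of strongly
# indissectible type

Mochizuki, *The geometry of Frobenioids II: poly-Frobenioids*, Kyushu J. Math. **62** (2008) 401–460,
§3, Theorem 3.6 (ix), kurims p. 38 [cite: MochizukiFrdII2008, Thm 3.6 (ix) p.38]: "(ix) Suppose that
`D` is of strongly indissectible type. If `D` is not complexifiable, then we assume further that
`Λ ≠ ℤ`. Then `F^istr` is of strongly indissectible type" — here for `F = A` ("[where, when `F = A`, we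
take `Λ = ℤ`]", Thm. 3.6 preamble p. 36), the angular Frobenioid `A π ⊆ C π` of isometries of Example
3.3 (iii) with its own pre-Frobenioid datum `A.toElem π` (`AngularFrobenioidsRelative.lean`, seat abc-iut-L1-t6),
over ANY base `π : D → D₀`. Companion of `ArchimedeanIndissectible.lean` (the case `F = C^ℤ`); DAG node
`FrdII:Thm3.6(ix)`, second half; discharges the second conjunct of abc-iut-L1-t9's `Thm36ix_CA`.

**Proof.** As for `C` (square in `D` by strong indissectibility, complex corner by complexifiability,
common refinement = a disc `B` over the corner with swapped Frobenius degrees), except that all arrows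
must now be ISOMETRIES: take `B` of tip `1`, the scalar towards `X₁` of absolute value `tip(X₁)`, and
towards `X₀` a `deg φ₀`-th root `s₀` of `ι₀(c₀)⁻¹ · ι₁(c₁) · s₁^{deg φ₁}`; since `φ₀`, `φ₁` are isometries
(`|cᵢ| · tip(Xᵢ)^{deg φᵢ} = tip(A)`), automatically `|s₀| = tip(X₀)`, so both arrows out of `B` are
isometries. `B` is non-initial in `A^istr` thanks to the two isometric endomorphisms `(id, 1, ±1)`.

**Status.** `thm36ix_A_of_isotropicIff` is PROVED granted Example 3.3 (ii) and (iii) "isotropic iff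
naively isotropic" / "isotropic in `A` iff isotropic in `C`" as hypotheses (`hiso`, `hisoA`); seat
abc-iut-L1-t6 has PROVED both (`Ex33ii_isotropic_iff_holds`, `Ex33iii_isotropic_iff_holds`,
`ArchimedeanIsotropy.lean`), so the last section records the UNCONDITIONAL theorems `thm36ix_C` (for
`C = C^ℤ`, from `ArchimedeanIndissectible.lean`) and `thm36ix_A`: DAG node `FrdII:Thm3.6(ix)` is closed
for `Λ = ℤ` over any base. Theorems only; classical; no statement of the paper is strengthened.
-/

namespace Literature.AlgebraicGeometry.Frobenioids

open CategoryTheory CategoryTheory.Limits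
open scoped Pointwise

universe v u

namespace ArchFrd

namespace Indissect

variable {D : Type u} [Category.{v} D] (π : D ⥤ D0)

/-! ### Isometries of `C` in terms of the `C₀`-data -/

/-- An arrow of `C = C₀ ×_{D₀} D` is an isometry iff its `C₀`-component is (the pull-backs of `Φ₀`
are identities). [cite: MochizukiFrdII2008, Ex 3.3 (iii) p.28] -/
theorem isIsometry_iff_fst {X Y : C π} (f : X ⟶ Y) :
    PreFrobenioid.IsIsometry (C.toElem π) f ↔ PreFrobenioid.IsIsometry C0.toElem f.fst := Iff.rfl

/-- An arrow `(b, d, c)` of `C` is an isometry iff `|c| · tip(A_L)^d = tip(A_K)`.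
[cite: MochizukiFrdII2008, Ex 3.3 (iii) p.28] -/
theorem isIsometry_iff_norm {X Y : C π} (f : X ⟶ Y) :
    PreFrobenioid.IsIsometry (C.toElem π) f ↔
      ‖(C0.scalar f.fst : ℂ)‖ * X.fst.tip ^ (C0.degFr f.fst : ℕ) = Y.fst.tip :=
  (isIsometry_iff_fst π f).trans (A0.isIsometry_iff_norm_mul_tip_pow f.fst)

/-! ### Non-initial objects of full subcategories of `A` -/

/-- An object of a full subcategory of the angular Frobenioid `A` whose angular region is a disc is
non-initial: it carries the two distinct isometric endomorphisms `(id, 1, 1)` and `(id, 1, -1)`.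
[cite: MochizukiFrdII2008, Thm 3.6 (ix) p.38] -/
theorem isNonemptyObj_A (P : ObjectProperty (A π)) (B : P.FullSubcategory)
    (hB : B.obj.obj.fst.IsNaivelyIsotropic) : IsNonemptyObj B := by
  refine ⟨fun hI => ?_⟩
  -- the endomorphism `(id, 1, -1)` of `B` in `C`
  let r : B.obj.obj ⟶ B.obj.obj :=
    { fst :=
        { base := 𝟙 B.obj.obj.fst.base, degFr := 1,
          scalar := -1,
          scalar_mem := by
            -- `-1 ∈ K^×` for `K = ℝ, ℂ` (cf. `ArchFrd.UnitStab.neg_one_mem_scalars`)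
            cases B.obj.obj.fst.base with
            | real => rw [D0.mem_scalars_real_iff]; simp
            | complex => exact Subgroup.mem_top _,
          mapsTo := by
            rw [PNat.one_coe, pow_one, C0.pullRegion_id]
            rintro _ ⟨u, hu, rfl⟩
            change (-1 : ℂˣ) * u ∈ B.obj.obj.fst.region.carrier
            rw [C0.mem_carrier_of_isIsotropic hB] at hu ⊢
            rw [← Subtype.coe_le_coe, coe_absHom] at hu ⊢
            rwa [Units.val_mul, norm_mul, Units.val_neg, Units.val_one, norm_neg, norm_one,
              one_mul] }
      snd := 𝟙 B.obj.obj.snd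
      w := by
        change 𝟙 _ ≫ B.obj.obj.iso.hom = B.obj.obj.iso.hom ≫ π.map (𝟙 B.obj.obj.snd)
        rw [CategoryTheory.Functor.map_id, Category.id_comp, Category.comp_id] }
  -- it is an isometry, hence an endomorphism of `B` in `A`
  have hr : PreFrobenioid.IsIsometry (C.toElem π) r := by
    rw [isIsometry_iff_norm]
    change ‖((-1 : ℂˣ) : ℂ)‖ * B.obj.obj.fst.tip ^ ((1 : ℕ+) : ℕ) = B.obj.obj.fst.tip
    rw [Units.val_neg, Units.val_one, norm_neg, norm_one, one_mul, PNat.one_coe, pow_one]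
  let rA : B.obj ⟶ B.obj := ⟨r, hr⟩
  have h := hI.hom_ext (P.homMk rA) (𝟙 B)
  have h' := congrArg (fun f : B ⟶ B =>
    ((C0.scalar (CFP.Hom.fst (InducedWideCategory.Hom.hom (InducedCategory.Hom.hom f))) : ℂˣ) : ℂ)) h
  change ((-1 : ℂˣ) : ℂ) = ((C0.scalar (𝟙 B.obj.obj.fst) : ℂˣ) : ℂ) at h'
  rw [C0.scalar_id', Units.val_neg, Units.val_one] at h'
  have h'' := congrArg Complex.re h'
  rw [Complex.neg_re, Complex.one_re] at h''
  norm_num at h''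

/-! ### Theorem 3.6 (ix) for the angular Frobenioid `A` -/

/-- **Theorem 3.6 (ix) for `F = A`** (the angular Frobenioid of Example 3.3 (iii), `Λ = ℤ`), over any
base `π : D → D₀`, GRANTED Example 3.3 (ii) and (iii) on isotropic objects (hypotheses `hiso`, `hisoA`
= seat abc-iut-L1-t6's named statements `Ex33ii_isotropic_iff π`, `Ex33iii_isotropic_iff π`): if `D`
is of strongly indissectible type [and complexifiable, forced since `Λ = ℤ`], then `A^istr` is of
strongly indissectible type. PROVED. [cite: MochizukiFrdII2008, Thm 3.6 (ix) p.38] -/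
theorem thm36ix_A_of_isotropicIff
    (hiso : ∀ X : C π, PreFrobenioid.IsIsotropic (C.toElem π) X ↔ X.fst.IsNaivelyIsotropic)
    (hisoA : ∀ X : A π,
      PreFrobenioid.IsIsotropic (A.toElem π) X ↔ PreFrobenioid.IsIsotropic (C.toElem π) X.obj) :
    Thm36ix (π ⋙ D0.toArchBase) (A.toElem π) MonoidType.Z := by
  intro hD hΛ
  have hcx : RC.IsComplexifiable (π ⋙ D0.toArchBase) := by
    by_contra h
    exact hΛ h rfl
  let P := PreFrobenioid.isotropicObjects (A.toElem π)
  refine ⟨fun Ah => ?_⟩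
  rintro ⟨X, φ, -, hsep⟩
  have hXi : ∀ i, (X i).obj.obj.fst.IsNaivelyIsotropic :=
    fun i => (hiso _).mp ((hisoA _).mp (X i).property)
  -- the two isometries of `C` underlying `φ 0`, `φ 1`
  set f₀ : (X 0).obj.obj ⟶ Ah.obj.obj := (φ 0).hom.1 with hf₀
  set f₁ : (X 1).obj.obj ⟶ Ah.obj.obj := (φ 1).hom.1 with hf₁
  -- Steps (1)–(2): a complex square downstairs
  obtain ⟨b, k₀, k₁, hb, hk⟩ :=
    exists_complex_square π hD hcx (fun i => (X i).obj.obj.snd) (fun i => (φ i).hom.1.snd)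
  -- data
  set d₀ : ℕ+ := C0.degFr f₀.fst with hd₀
  set d₁ : ℕ+ := C0.degFr f₁.fst with hd₁
  set c₀ : ℂˣ := C0.scalar f₀.fst with hc₀
  set c₁ : ℂˣ := C0.scalar f₁.fst with hc₁
  set e₀ : π.obj b ⟶ (X 0).obj.obj.fst.base := π.map k₀ ≫ (X 0).obj.obj.iso.inv with he₀
  set e₁ : π.obj b ⟶ (X 1).obj.obj.fst.base := π.map k₁ ≫ (X 1).obj.obj.iso.inv with he₁
  set T₀ : PosReal := (X 0).obj.obj.fst.region.tip with hT₀
  set T₁ : PosReal := (X 1).obj.obj.fst.region.tip with hT₁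
  have hT₀tip : (X 0).obj.obj.fst.tip = (T₀ : ℝ) := rfl
  have hT₁tip : (X 1).obj.obj.fst.tip = (T₁ : ℝ) := rfl
  -- the isometry equations of `φ 0`, `φ 1`
  have hφ₀ : ‖(c₀ : ℂ)‖ * (T₀ : ℝ) ^ (d₀ : ℕ) = Ah.obj.obj.fst.tip :=
    (isIsometry_iff_norm π f₀).mp (φ 0).hom.2
  have hφ₁ : ‖(c₁ : ℂ)‖ * (T₁ : ℝ) ^ (d₁ : ℕ) = Ah.obj.obj.fst.tip :=
    (isIsometry_iff_norm π f₁).mp (φ 1).hom.2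
  have hsc : ∀ s : ℂˣ, s ∈ D0.scalars (π.obj b) := fun s => by
    rw [show π.obj b = D0.complex from hb, D0.scalars_complex]; exact Subgroup.mem_top _
  -- scalars: `s₁ = tip(X₁)`, `s₀` a `d₀`-th root of `ι₀(c₀)⁻¹ · (ι₁(c₁) · s₁^{d₁})`
  set s₁ : ℂˣ := ofPosReal ℂ T₁ with hs₁
  have hs₁n : ‖(s₁ : ℂ)‖ = (T₁ : ℝ) := by
    -- `‖r‖ = r` for a positive real scalar (cf. `ArchFrd.C0.norm_coe_ofPosReal`)
    rw [hs₁, ← coe_absHom, absHom_ofPosReal]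
  set w : ℂˣ := (e₀.act c₀)⁻¹ * (e₁.act c₁ * s₁ ^ (d₁ : ℕ)) with hw
  obtain ⟨s₀, hs₀⟩ := exists_units_pow_eq w d₀.pos
  have hc₀n : 0 < ‖(c₀ : ℂ)‖ := norm_pos_iff.mpr c₀.ne_zero
  have hwn : ‖(w : ℂ)‖ = (T₀ : ℝ) ^ (d₀ : ℕ) := by
    have h1 : ‖(w : ℂ)‖ = ‖(c₀ : ℂ)‖⁻¹ * (‖(c₁ : ℂ)‖ * (T₁ : ℝ) ^ (d₁ : ℕ)) := by
      rw [hw, Units.val_mul, Units.val_mul, norm_mul, norm_mul, Units.val_inv_eq_inv_val, norm_inv,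
        Units.val_pow_eq_pow_val, norm_pow, hs₁n]
      change ‖((D0.galAct _ c₀ : ℂˣ) : ℂ)‖⁻¹ * (‖((D0.galAct _ c₁ : ℂˣ) : ℂ)‖ * _) = _
      rw [D0.norm_galAct, D0.norm_galAct]
    rw [h1, hφ₁, ← hφ₀, ← mul_assoc, inv_mul_cancel₀ hc₀n.ne', one_mul]
  have hs₀n : ‖(s₀ : ℂ)‖ = (T₀ : ℝ) := by
    have h1 : ‖(s₀ : ℂ)‖ ^ (d₀ : ℕ) = (T₀ : ℝ) ^ (d₀ : ℕ) := by
      rw [← norm_pow, ← Units.val_pow_eq_pow_val, hs₀, hwn]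
    exact (pow_left_inj₀ (norm_nonneg _) T₀.2.le d₀.ne_zero).mp h1
  -- the refinement: the disc of tip `1` over `b`, and the two ISOMETRIES out of it
  have hst₀ : ‖(s₀ : ℂ)‖ * ((1 : PosReal) : ℝ) ^ (d₁ : ℕ) ≤ ((X 0).obj.obj.fst.region.tip : ℝ) := by
    rw [Positive.val_one, one_pow, mul_one, hs₀n]
  have hst₁ : ‖(s₁ : ℂ)‖ * ((1 : PosReal) : ℝ) ^ (d₀ : ℕ) ≤ ((X 1).obj.obj.fst.region.tip : ℝ) := by
    rw [Positive.val_one, one_pow, mul_one, hs₁n]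
  let B : C π :=
    ⟨⟨π.obj b, AngularRegion.isotropicOfTip 1, fun _ => AngularRegion.isIsotropic_isotropicOfTip _⟩,
      b, Iso.refl _⟩
  have hBn : B.fst.IsNaivelyIsotropic := AngularRegion.isIsotropic_isotropicOfTip _
  have hBtip : B.fst.tip = 1 := Positive.val_one
  have hB : P ⟨B⟩ := (hisoA ⟨B⟩).mpr ((hiso B).mpr hBn)
  let ψ₀ : B ⟶ (X 0).obj.obj :=
    { fst :=
        { base := e₀, degFr := d₁, scalar := s₀, scalar_mem := hsc s₀,
          mapsTo := smul_disc_pow_subset_pullRegion (X 0).obj.obj.fst (hXi 0) e₀ 1 d₁ s₀ hst₀ }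
      snd := k₀
      w := by
        change (π.map k₀ ≫ (X 0).obj.obj.iso.inv) ≫ (X 0).obj.obj.iso.hom = 𝟙 _ ≫ π.map k₀
        rw [Category.assoc, Iso.inv_hom_id, Category.comp_id, Category.id_comp] }
  let ψ₁ : B ⟶ (X 1).obj.obj :=
    { fst :=
        { base := e₁, degFr := d₀, scalar := s₁, scalar_mem := hsc s₁,
          mapsTo := smul_disc_pow_subset_pullRegion (X 1).obj.obj.fst (hXi 1) e₁ 1 d₀ s₁ hst₁ }
      snd := k₁
      w := by
        change (π.map k₁ ≫ (X 1).obj.obj.iso.inv) ≫ (X 1).obj.obj.iso.hom = 𝟙 _ ≫ π.map k₁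
        rw [Category.assoc, Iso.inv_hom_id, Category.comp_id, Category.id_comp] }
  have hψ₀ : PreFrobenioid.IsIsometry (C.toElem π) ψ₀ := by
    rw [isIsometry_iff_norm, hBtip]
    change ‖(s₀ : ℂ)‖ * (1 : ℝ) ^ (d₁ : ℕ) = (T₀ : ℝ)
    rw [one_pow, mul_one, hs₀n]
  have hψ₁ : PreFrobenioid.IsIsometry (C.toElem π) ψ₁ := by
    rw [isIsometry_iff_norm, hBtip]
    change ‖(s₁ : ℂ)‖ * (1 : ℝ) ^ (d₀ : ℕ) = (T₁ : ℝ)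
    rw [one_pow, mul_one, hs₁n]
  -- the two composites `B → A` coincide in `C`
  have heq : ψ₀ ≫ f₀ = ψ₁ ≫ f₁ := by
    refine CFP.hom_ext (C0.hom_ext ?_ ?_ ?_) ?_
    · have b0 : C0.Base (ψ₀ ≫ f₀).fst = π.map (k₀ ≫ f₀.snd) ≫ Ah.obj.obj.iso.inv :=
        (Category.id_comp _).symm.trans (PreFrobenioid.FiberProduct.inv_comp_base (ψ₀ ≫ f₀))
      have b1 : C0.Base (ψ₁ ≫ f₁).fst = π.map (k₁ ≫ f₁.snd) ≫ Ah.obj.obj.iso.inv :=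
        (Category.id_comp _).symm.trans (PreFrobenioid.FiberProduct.inv_comp_base (ψ₁ ≫ f₁))
      rw [b0, b1, hk]
    · rw [CFP.comp_fst, CFP.comp_fst, C0.degFr_comp', C0.degFr_comp']
      change d₁ * d₀ = d₀ * d₁
      exact mul_comm _ _
    · rw [CFP.comp_fst, CFP.comp_fst, C0.scalar_comp', C0.scalar_comp']
      change e₀.act c₀ * s₀ ^ (d₀ : ℕ) = e₁.act c₁ * s₁ ^ (d₁ : ℕ)
      rw [hs₀, hw, mul_inv_cancel_left]
    · change k₀ ≫ f₀.snd = k₁ ≫ f₁.snd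
      exact hk
  -- … hence in `A^istr`
  let BA : P.FullSubcategory := ⟨⟨B⟩, hB⟩
  let Ψ₀ : BA ⟶ X 0 := P.homMk ⟨ψ₀, hψ₀⟩
  let Ψ₁ : BA ⟶ X 1 := P.homMk ⟨ψ₁, hψ₁⟩
  refine hsep (i := 0) (j := 1) (by decide) (isNonemptyObj_A π P BA hBn) Ψ₀ Ψ₁ ?_
  exact InducedCategory.hom_ext (InducedWideCategory.Hom.ext heq)

/-! ### Theorem 3.6 (ix), UNCONDITIONAL (Example 3.3 (ii)/(iii) proved by seat abc-iut-L1-t6) -/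

/-- **Theorem 3.6 (ix) for `C = C^ℤ`, UNCONDITIONAL** over any base `π : D → D₀`: if `D` is of strongly
indissectible type (and — forced by the printed proviso since `Λ = ℤ` — complexifiable), then `C^istr`
is of strongly indissectible type. [cite: MochizukiFrdII2008, Thm 3.6 (ix) p.38] -/
theorem thm36ix_C : Thm36ix (π ⋙ D0.toArchBase) (C.toElem π) MonoidType.Z :=
  thm36ix_C_of_isotropicIff π (Ex33ii_isotropic_iff_holds π)

/-- **Theorem 3.6 (ix) for the angular Frobenioid `A`, UNCONDITIONAL** over any base `π : D → D₀`: under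
the same hypotheses `A^istr` is of strongly indissectible type. [cite: MochizukiFrdII2008, Thm 3.6 (ix) p.38] -/
theorem thm36ix_A : Thm36ix (π ⋙ D0.toArchBase) (A.toElem π) MonoidType.Z :=
  thm36ix_A_of_isotropicIff π (Ex33ii_isotropic_iff_holds π) (Ex33iii_isotropic_iff_holds π)

end Indissect

end ArchFrd

end Literature.AlgebraicGeometry.Frobenioids
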